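import Summits.Ventures.LatticeQCDFlow.Scaling.SwapSpacingOptimum
import Summits.Ventures.LatticeQCDFlow.Scaling.SwapSpacingBrackets

/-!
HONEST FRAMING: exact (Metropolis-corrected) sampling algorithms for lattice gauge theory; figures
of merit are autocorrelation/cost numbers at stated couplings and volumes; no continuum-physics
claim.

# SwapLadderDEOBarrier — ADDING REPLICAS TO A FLAT GAUSSIAN LADDER AT FIXED TOTAL STIFFNESS STRICTLY
# LOWERS THE DEO INEFFICIENCY `Σ_i r_i/s_i = K·erf(c/K)/erfc(c/K)`, WHOSE INFIMUM IS THE BARRIER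
# `2c/√π = Λ/√(2π)`, NEVER ATTAINED; `1/erfc` IS STRICTLY CONVEX (row 22 `su3-ptbc`, GEN-6, ours; part 1 of 2 —
# the round-trip consequences, linear DEO versus quadratic reversible growth, are `SwapLadderDEOBarrierRoundTrip`)

Venture `LatticeQCDFlow` (cell pub-lqcd), topic `Scaling`; FANOUT row 22 (`su3-ptbc`, PTBC comparator arm E4).
NEW WORK of the cell = elementary real analysis over GEN-4's `SwapSpacingOptimum` (`erf`, `erfc`,
`hasDerivAt_erfc`, `continuous_erfc`, `erfc_zero`, `erfc_lt_one_of_pos`) and `SwapSpacingBrackets` (the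
alternating Maclaurin brackets `partialSum_even_le_erf` / `erf_le_partialSum_odd`, `1.12836 < 2/√π`), the
Literature bound `erfc x < e^{−x²}/(x√π)` (`BrentZimmermann2010.AsymptoticExpansions.erfc_lt_leadFactor`) and
Mathlib's convexity API (`StrictMono.strictConvexOn_univ_of_deriv`, `StrictConvexOn.secant_strict_mono`,
`Antitone.le_of_tendsto`).  Nothing is cited as a fact; no `native_decide`.

THE MODEL (GEN-4/GEN-5's; NOT claimed to describe PTBC — the card MEASURES round trips).  GEN-4
(`SwapLadderMinimax`, `SwapAcceptanceOptimum`): the boundary-condition ladder is a stiffness interval of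
length `Λ`; adjacent replicas at stiffness distance `ℓ` accept a swap with stationary probability
`erfc(ℓ/(2√2))`.  With `u = ℓ/(2√2)` and the REDUCED total stiffness `c = Λ/(2√2)`, a flat ladder of `K`
intervals has `u = c/K`, pair acceptance `s = erfc(c/K)`, rejection `r = erf(c/K)`.  GEN-5
(`SwapLadderRoundTripDEO.deo_round_trip`, our derivation of Syed–Bouchard-Côté–Deligiannidis–Doucet, JRSS-B 84
(2022) 321, Thm 1): under the DETERMINISTIC even–odd scheme — the one row 22's driver `ptbc_lf.swap_step` runs —
the idealised round trip is `2(K+1)(1 + Σ_{i<K} r_i/s_i)` scans (reversible scheme: `2(K+1)(K + Σ_i r_i/s_i)`).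
For the flat ladder `Σ_{i<K} r_i/s_i = deoBarrier c K` below (`deoBarrier_eq_sum`).

## What is proved

§1 `erf_le_two_div_sqrt_pi_mul` (`erf x ≤ 2x/√π`, `x ≥ 0`), `two_div_sqrt_pi_mul_sub_le_erf`
   (`(2/√π)(x − x³/3) ≤ erf x`, `0 ≤ x ≤ 1`), `erf_nonneg_of_nonneg`, `erfc_le_one_of_nonneg`.
§2 `swapRejOdds u = erf u/erfc u` (`= 1/erfc u − 1 = (1 − s)/s`, the pair's `r/s`); brackets
   `(2/√π)(u − u³/3) ≤ swapRejOdds u ≤ (2u/√π)/(1 − 2u/√π)` (`le_swapRejOdds`, `swapRejOdds_le`).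
§3 **`strictConvexOn_inv_erfc`** — `1/erfc` is STRICTLY CONVEX on `ℝ` (`deriv = (2/√π)e^{−u²}/erfc²` is strictly
   increasing since `u·erfc u < (2/√π)e^{−u²}`, `mul_erfc_lt_two_div_sqrt_pi_mul_exp`); hence
   **`swapRejOdds_div_strictMonoOn`** — `u ↦ (r/s)(u)/u` is strictly increasing on `(0,∞)` (secants from `0`).
§4 `deoBarrier c K = K·(r/s)(c/K)` (`_eq_flat`: `K(1 − a)/a`, `a = erfc(c/K)`, the shape of GEN-5's
   `deo_round_trip_const`; `_eq_sum`; `_eq_mul_div`: `= c·(r/s)(u)/u` at `u = c/K`);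
   **`deoBarrier_strictAntiOn`** — for `c > 0` STRICTLY DECREASING on `K ≥ 1`: every added replica lowers
   `Σ_i r_i/s_i`; **`le_deoBarrier` / `deoBarrier_le`** — `(2c/√π)(1 − c²/(3K²)) ≤ deoBarrier c K ≤
   (2c/√π)/(1 − 2c/(√πK))` (`K ≥ c`, resp. `K > 2c/√π`); **`tendsto_deoBarrier`** — the limit, hence the
   infimum, is `2c/√π`; **`lt_deoBarrier`** — never attained; `two_div_sqrt_pi_mul_reduced` — `2c/√π = Λ/√(2π)`.
   `Λ/√(2π) = lim_K Σ_i r_i` is this model's value of Syed et al.'s global communication barrier `∫λ` (NAMED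
   ONLY; their Thm 3 dichotomy is drawn in the sequel).

READING FOR ROW 22 (CARD §1.5, replica-count lever; model only): GEN-4's `N_r` law fixes the MINIMAL count for a
target pair acceptance; under the driver's own swap scheme every EXTRA replica lowers `Σ r/s` strictly, towards
`Λ/√(2π)` — so the DEO round trip per replica `1 + Σ r/s` falls and the round trip grows at most linearly in
`K` (sequel), where a reversible scheme's grows quadratically.  NOT CLAIMED: that PTBC obeys the model or
'efficient local exploration'; non-flat ladders; any autocorrelation time; any number of a run.
-/

noncomputable section

open Real Set Filter Topology
open Literature.Analysis.SpecialFunctions (erf erfTerm erf_le_erf)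
open Literature.ComputerArithmetic.BrentZimmermann2010.AsymptoticExpansions (erfc erfc_pos leadFactor
  erfc_lt_leadFactor)

namespace Summit.Ventures.LatticeQCDFlow.Scaling

/-! ## §1 The first two Maclaurin brackets of `erf` -/

section ErfBrackets

/-- **`erf x ≤ 2x/√π` for `x ≥ 0`** (one Maclaurin term for `x ≤ 1`; `erf < 1 < 2/√π ≤ 2x/√π` beyond).
[folklore] -/
theorem erf_le_two_div_sqrt_pi_mul {x : ℝ} (hx : 0 ≤ x) : erf x ≤ 2 / sqrt π * x := by
  rcases le_or_gt x 1 with hx1 | hx1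
  · have h := erf_le_partialSum_odd hx hx1 0
    have hs : ∑ i ∈ Finset.range (2 * 0 + 1), (-1 : ℝ) ^ i * erfTerm x i = x := by
      simp [erfTerm]
    rwa [hs] at h
  · have h1 : erf x < 1 := by
      have := erfc_pos x
      unfold Literature.ComputerArithmetic.BrentZimmermann2010.AsymptoticExpansions.erfc at this
      linarith
    have h2 : (1 : ℝ) < 2 / sqrt π * x := by
      have h3 := lt_two_div_sqrt_pi
      nlinarith
    linarith

/-- **`(2/√π)(x − x³/3) ≤ erf x` for `0 ≤ x ≤ 1`** (two Maclaurin terms). [folklore] -/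
theorem two_div_sqrt_pi_mul_sub_le_erf {x : ℝ} (hx0 : 0 ≤ x) (hx1 : x ≤ 1) :
    2 / sqrt π * (x - x ^ 3 / 3) ≤ erf x := by
  have h := partialSum_even_le_erf hx0 hx1 1
  have hs : ∑ i ∈ Finset.range (2 * 1), (-1 : ℝ) ^ i * erfTerm x i = x - x ^ 3 / 3 := by
    simp [Finset.sum_range_succ, erfTerm]
    ring
  rwa [hs] at h

/-- `0 ≤ erf x` for `x ≥ 0`. [folklore] -/
theorem erf_nonneg_of_nonneg {x : ℝ} (hx : 0 ≤ x) : 0 ≤ erf x := by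
  have h := erf_le_erf le_rfl hx
  rwa [erf_zero] at h

/-- `erfc x ≤ 1` for `x ≥ 0`. [folklore] -/
theorem erfc_le_one_of_nonneg {x : ℝ} (hx : 0 ≤ x) : erfc x ≤ 1 := by
  have h := erf_nonneg_of_nonneg hx
  show 1 - erf x ≤ 1
  linarith

end ErfBrackets

/-! ## §2 The pair rejection odds `r/s = erf u/erfc u` -/

section RejOdds

/-- **Rejection odds of the model swap at reduced spacing `u`**: `swapRejOdds u = erf u/erfc u = r/s` with
`s = erfc u` the pair acceptance and `r = 1 − s`. [ours] -/
def swapRejOdds (u : ℝ) : ℝ := erf u / erfc u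

/-- `r/s = 1/erfc − 1`. [ours] -/
theorem swapRejOdds_eq_inv_sub (u : ℝ) : swapRejOdds u = (erfc u)⁻¹ - 1 := by
  have h : erfc u ≠ 0 := (erfc_pos u).ne'
  unfold swapRejOdds
  have he : erf u = 1 - erfc u := by
    show erf u = 1 - (1 - erf u); ring
  rw [he]
  field_simp

/-- `r/s = (1 − s)/s` with `s = erfc u`. [ours] -/
theorem swapRejOdds_eq_div (u : ℝ) : swapRejOdds u = (1 - erfc u) / erfc u := by
  unfold swapRejOdds
  congr 1
  show erf u = 1 - (1 - erf u); ring

/-- `0 ≤ r/s` for `u ≥ 0`. [ours] -/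
theorem swapRejOdds_nonneg {u : ℝ} (hu : 0 ≤ u) : 0 ≤ swapRejOdds u :=
  div_nonneg (erf_nonneg_of_nonneg hu) (erfc_pos u).le

/-- `0 < r/s` for `u > 0`. [ours] -/
theorem swapRejOdds_pos {u : ℝ} (hu : 0 < u) : 0 < swapRejOdds u := by
  rw [swapRejOdds_eq_div]
  exact div_pos (by linarith [erfc_lt_one_of_pos hu]) (erfc_pos u)

/-- **Upper bracket**: for `u ≥ 0` with `2u/√π < 1`, `r/s ≤ (2u/√π)/(1 − 2u/√π)`. [ours] -/
theorem swapRejOdds_le {u : ℝ} (hu : 0 ≤ u) (hu1 : 2 / sqrt π * u < 1) :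
    swapRejOdds u ≤ (2 / sqrt π * u) / (1 - 2 / sqrt π * u) := by
  have he := erf_le_two_div_sqrt_pi_mul hu
  have hc : 1 - 2 / sqrt π * u ≤ erfc u := by
    show 1 - 2 / sqrt π * u ≤ 1 - erf u; linarith
  have hpos : 0 < 1 - 2 / sqrt π * u := by linarith
  unfold swapRejOdds
  calc erf u / erfc u ≤ (2 / sqrt π * u) / erfc u :=
        div_le_div_of_nonneg_right he (erfc_pos u).le
    _ ≤ (2 / sqrt π * u) / (1 - 2 / sqrt π * u) :=
        div_le_div_of_nonneg_left (by positivity) hpos hc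

/-- **Lower bracket**: for `0 ≤ u ≤ 1`, `(2/√π)(u − u³/3) ≤ r/s` (`erfc ≤ 1`). [ours] -/
theorem le_swapRejOdds {u : ℝ} (hu0 : 0 ≤ u) (hu1 : u ≤ 1) :
    2 / sqrt π * (u - u ^ 3 / 3) ≤ swapRejOdds u := by
  have he := two_div_sqrt_pi_mul_sub_le_erf hu0 hu1
  have h1 := erfc_le_one_of_nonneg hu0
  have h0 := erf_nonneg_of_nonneg hu0
  unfold swapRejOdds
  calc 2 / sqrt π * (u - u ^ 3 / 3) ≤ erf u := he
    _ = erf u / 1 := (div_one _).symm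
    _ ≤ erf u / erfc u := div_le_div_of_nonneg_left h0 (erfc_pos u) h1

end RejOdds

/-! ## §3 `1/erfc` is strictly convex; the rejection odds per unit spacing increase with the spacing -/

section Convex

/-- The derivative of `1/erfc`: `(2/√π)e^{−u²}/erfc(u)²`. [ours] -/
theorem hasDerivAt_inv_erfc (u : ℝ) :
    HasDerivAt (fun y => (erfc y)⁻¹) (2 / sqrt π * exp (-(u ^ 2)) / erfc u ^ 2) u := by
  have h := (hasDerivAt_erfc u).inv (erfc_pos u).ne'
  have e : -(-(2 / sqrt π * exp (-(u ^ 2)))) / erfc u ^ 2 = 2 / sqrt π * exp (-(u ^ 2)) / erfc u ^ 2 := by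
    rw [neg_neg]
  rw [e] at h
  exact h

/-- `deriv (1/erfc) = (2/√π)e^{−u²}/erfc²`. [ours] -/
theorem deriv_inv_erfc : deriv (fun y => (erfc y)⁻¹) = fun u => 2 / sqrt π * exp (-(u ^ 2)) / erfc u ^ 2 :=
  funext fun u => (hasDerivAt_inv_erfc u).deriv

/-- The derivative of `(2/√π)e^{−u²}/erfc²`:
`(2/√π)e^{−u²}·2·((2/√π)e^{−u²} − u·erfc u)/erfc³`. [ours] -/
theorem hasDerivAt_deriv_inv_erfc (u : ℝ) :
    HasDerivAt (fun y => 2 / sqrt π * exp (-(y ^ 2)) / erfc y ^ 2)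
      (2 / sqrt π * exp (-(u ^ 2)) * (2 * (2 / sqrt π * exp (-(u ^ 2)) - u * erfc u)) / erfc u ^ 3) u := by
  have h0 : HasDerivAt (fun y : ℝ => y ^ 2) (2 * u) u := by simpa using hasDerivAt_pow 2 u
  have h1 : HasDerivAt (fun y : ℝ => -(y ^ 2)) (-(2 * u)) u := h0.neg
  have hE : HasDerivAt (fun y => 2 / sqrt π * exp (-(y ^ 2))) (2 / sqrt π * (exp (-(u ^ 2)) * (-(2 * u)))) u :=
    (h1.exp).const_mul _
  have hQ : HasDerivAt (fun y => erfc y ^ 2) ((2 : ℕ) * erfc u ^ (2 - 1) * (-(2 / sqrt π * exp (-(u ^ 2))))) u :=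
    (hasDerivAt_erfc u).pow 2
  have hQ' : HasDerivAt (fun y => erfc y ^ 2) (2 * erfc u * (-(2 / sqrt π * exp (-(u ^ 2))))) u := by
    simpa using hQ
  have h := hE.div hQ' (pow_ne_zero 2 (erfc_pos u).ne')
  have hc : erfc u ≠ 0 := (erfc_pos u).ne'
  have e : (2 / sqrt π * (exp (-(u ^ 2)) * (-(2 * u))) * erfc u ^ 2 -
      2 / sqrt π * exp (-(u ^ 2)) * (2 * erfc u * (-(2 / sqrt π * exp (-(u ^ 2)))))) / (erfc u ^ 2) ^ 2
      = 2 / sqrt π * exp (-(u ^ 2)) * (2 * (2 / sqrt π * exp (-(u ^ 2)) - u * erfc u)) / erfc u ^ 3 := by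
    field_simp
    ring
  rw [e] at h
  exact h

/-- **`u·erfc u < (2/√π)e^{−u²}` for every real `u`** (for `u > 0` from the Literature bound
`erfc u < e^{−u²}/(u√π)`; trivial for `u ≤ 0`).  (The sharper `u·erfc u < e^{−u²}/√π` is the tree's
`SwapLadderLogConcave.mul_erfc_lt`, not importable here while its olean is unbuilt; this weaker form is all
§3 needs.) [ours] -/
theorem mul_erfc_lt_two_div_sqrt_pi_mul_exp (u : ℝ) : u * erfc u < 2 / sqrt π * exp (-(u ^ 2)) := by
  have hE : 0 < 2 / sqrt π * exp (-(u ^ 2)) := by positivity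
  rcases le_or_gt u 0 with hu | hu
  · have : u * erfc u ≤ 0 := mul_nonpos_of_nonpos_of_nonneg hu (erfc_pos u).le
    linarith
  · have h := erfc_lt_leadFactor hu
    unfold Literature.ComputerArithmetic.BrentZimmermann2010.AsymptoticExpansions.leadFactor at h
    have hsq : 0 < sqrt π := by positivity
    have h2 : u * erfc u < exp (-(u ^ 2)) / sqrt π := by
      have := mul_lt_mul_of_pos_left h hu
      calc u * erfc u < u * (exp (-(u ^ 2)) / (u * sqrt π)) := this
        _ = exp (-(u ^ 2)) / sqrt π := by field_simp
    calc u * erfc u < exp (-(u ^ 2)) / sqrt π := h2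
      _ ≤ 2 / sqrt π * exp (-(u ^ 2)) := by
          rw [div_eq_mul_inv, div_eq_mul_inv]
          nlinarith [exp_pos (-(u ^ 2)), inv_pos.mpr hsq]

/-- The derivative of `1/erfc` is strictly increasing on `ℝ`. [ours] -/
theorem strictMono_deriv_inv_erfc : StrictMono (deriv fun y => (erfc y)⁻¹) := by
  rw [deriv_inv_erfc]
  refine strictMono_of_deriv_pos fun u => ?_
  rw [(hasDerivAt_deriv_inv_erfc u).deriv]
  have h1 := mul_erfc_lt_two_div_sqrt_pi_mul_exp u
  have h2 : 0 < 2 * (2 / sqrt π * exp (-(u ^ 2)) - u * erfc u) := by linarith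
  have h3 : 0 < erfc u ^ 3 := pow_pos (erfc_pos u) 3
  positivity

/-- **`1/erfc` is strictly convex on `ℝ`.** [ours] -/
theorem strictConvexOn_inv_erfc : StrictConvexOn ℝ univ fun y => (erfc y)⁻¹ :=
  StrictMono.strictConvexOn_univ_of_deriv
    ((continuous_erfc.inv₀ fun u => (erfc_pos u).ne')) strictMono_deriv_inv_erfc

/-- **The rejection odds per unit reduced spacing, `(r/s)(u)/u = (1/erfc u − 1)/u`, are STRICTLY INCREASING in
`u > 0`** (secant slopes from the origin of the strictly convex `1/erfc`, `1/erfc 0 = 1`). [ours] -/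
theorem swapRejOdds_div_strictMonoOn : StrictMonoOn (fun u => swapRejOdds u / u) (Ioi 0) := by
  intro x hx y hy hxy
  have h := strictConvexOn_inv_erfc.secant_strict_mono (a := 0) (mem_univ _) (mem_univ _) (mem_univ _)
    (ne_of_gt hx) (ne_of_gt hy) hxy
  simp only [erfc_zero, inv_one, sub_zero] at h
  simpa only [swapRejOdds_eq_inv_sub] using h

/-- Pointwise form: `0 < x < y ⇒ (r/s)(x)/x < (r/s)(y)/y`. [ours] -/
theorem swapRejOdds_div_lt {x y : ℝ} (hx : 0 < x) (hxy : x < y) :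
    swapRejOdds x / x < swapRejOdds y / y :=
  swapRejOdds_div_strictMonoOn hx (hx.trans hxy) hxy

end Convex

/-! ## §4 The flat-ladder inefficiency `Σ_i r_i/s_i = K·(r/s)(c/K)`: monotone in `K`, limit `2c/√π` -/

section Barrier

/-- **The DEO inefficiency of the flat `K`-interval Gaussian ladder of reduced total stiffness `c = Λ/(2√2)`**:
`deoBarrier c K = K·erf(c/K)/erfc(c/K) = Σ_{i<K} r_i/s_i`. [ours] -/
def deoBarrier (c : ℝ) (K : ℕ) : ℝ := (K : ℝ) * swapRejOdds (c / K)

/-- Flat-profile form `K·(1 − a)/a`, `a = erfc(c/K)` — the shape of GEN-5's `deo_round_trip_const`. [ours] -/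
theorem deoBarrier_eq_flat (c : ℝ) (K : ℕ) : deoBarrier c K = K * ((1 - erfc (c / K)) / erfc (c / K)) := by
  rw [deoBarrier, swapRejOdds_eq_div]

/-- As the sum `Σ_{i<K} r_i/s_i` of GEN-5's `deo_round_trip` for the constant profile `a_i = erfc(c/K)`. [ours] -/
theorem deoBarrier_eq_sum (c : ℝ) (K : ℕ) :
    deoBarrier c K = ∑ _i ∈ Finset.range K, (1 - erfc (c / K)) / erfc (c / K) := by
  rw [Finset.sum_const, Finset.card_range, nsmul_eq_mul, deoBarrier_eq_flat]

/-- `deoBarrier c K = c·((r/s)(u)/u)` at `u = c/K` (`c ≠ 0`, `K ≠ 0`). [ours] -/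
theorem deoBarrier_eq_mul_div {c : ℝ} (hc : c ≠ 0) {K : ℕ} (hK : K ≠ 0) :
    deoBarrier c K = c * (swapRejOdds (c / K) / (c / K)) := by
  have hK' : (K : ℝ) ≠ 0 := Nat.cast_ne_zero.mpr hK
  unfold deoBarrier
  field_simp

/-- `0 ≤ deoBarrier c K` for `c ≥ 0`. [ours] -/
theorem deoBarrier_nonneg {c : ℝ} (hc : 0 ≤ c) (K : ℕ) : 0 ≤ deoBarrier c K :=
  mul_nonneg (Nat.cast_nonneg K) (swapRejOdds_nonneg (div_nonneg hc (Nat.cast_nonneg K)))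

/-- `0 < deoBarrier c K` for `c > 0`, `K ≥ 1`. [ours] -/
theorem deoBarrier_pos {c : ℝ} (hc : 0 < c) {K : ℕ} (hK : 1 ≤ K) : 0 < deoBarrier c K := by
  have hK0 : (0 : ℝ) < K := by exact_mod_cast hK
  exact mul_pos hK0 (swapRejOdds_pos (div_pos hc hK0))

/-- **Every added replica strictly lowers `Σ_i r_i/s_i`**: `K ↦ deoBarrier c K` is strictly decreasing on
`K ≥ 1` (`c > 0`). [ours] -/
theorem deoBarrier_strictAntiOn {c : ℝ} (hc : 0 < c) :
    StrictAntiOn (fun K : ℕ => deoBarrier c K) (Ici 1) := by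
  intro K hK K' hK' hKK'
  have hK1 : 1 ≤ K := hK
  have hK'1 : 1 ≤ K' := hK'
  have hK0 : (0 : ℝ) < K := by exact_mod_cast hK1
  have hK'0 : (0 : ℝ) < K' := by exact_mod_cast hK'1
  have hlt : (K : ℝ) < K' := by exact_mod_cast hKK'
  show deoBarrier c K' < deoBarrier c K
  rw [deoBarrier_eq_mul_div hc.ne' (by omega), deoBarrier_eq_mul_div hc.ne' (by omega)]
  exact mul_lt_mul_of_pos_left
    (swapRejOdds_div_lt (div_pos hc hK'0) (div_lt_div_of_pos_left hc hK0 hlt)) hc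

/-- Successor form: `deoBarrier c (K+1) < deoBarrier c K` for `K ≥ 1`. [ours] -/
theorem deoBarrier_succ_lt {c : ℝ} (hc : 0 < c) {K : ℕ} (hK : 1 ≤ K) :
    deoBarrier c (K + 1) < deoBarrier c K :=
  deoBarrier_strictAntiOn hc (show (1 : ℕ) ≤ K from hK) (show (1 : ℕ) ≤ K + 1 by omega) (Nat.lt_succ_self K)

/-- **Upper bracket**: `deoBarrier c K ≤ (2c/√π)/(1 − 2c/(√π K))` once `K > 2c/√π`. [ours] -/
theorem deoBarrier_le {c : ℝ} (hc : 0 ≤ c) {K : ℕ} (hK : 2 / sqrt π * c < K) :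
    deoBarrier c K ≤ (2 / sqrt π * c) / (1 - 2 / sqrt π * c / K) := by
  have hK0 : (0 : ℝ) < K := lt_of_le_of_lt (by positivity) hK
  have hu1 : 2 / sqrt π * (c / K) < 1 := by
    rw [← mul_div_assoc, div_lt_one hK0]; exact hK
  have h := swapRejOdds_le (div_nonneg hc hK0.le) hu1
  have hK' : (K : ℝ) ≠ 0 := hK0.ne'
  unfold deoBarrier
  calc (K : ℝ) * swapRejOdds (c / K) ≤ K * ((2 / sqrt π * (c / K)) / (1 - 2 / sqrt π * (c / K))) :=
        mul_le_mul_of_nonneg_left h hK0.le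
    _ = (2 / sqrt π * c) / (1 - 2 / sqrt π * c / K) := by
        rw [← mul_div_assoc (2 / sqrt π) c (K : ℝ), ← mul_div_assoc]
        congr 1
        field_simp

/-- **Lower bracket**: `(2c/√π)(1 − c²/(3K²)) ≤ deoBarrier c K` for `1 ≤ K`, `c ≤ K`. [ours] -/
theorem le_deoBarrier {c : ℝ} (hc : 0 ≤ c) {K : ℕ} (hK1 : 1 ≤ K) (hcK : c ≤ K) :
    2 / sqrt π * c * (1 - c ^ 2 / (3 * (K : ℝ) ^ 2)) ≤ deoBarrier c K := by
  have hK0 : (0 : ℝ) < K := by exact_mod_cast hK1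
  have hu1 : c / K ≤ 1 := (div_le_one hK0).mpr hcK
  have h := le_swapRejOdds (div_nonneg hc hK0.le) hu1
  have hK' : (K : ℝ) ≠ 0 := hK0.ne'
  unfold deoBarrier
  calc 2 / sqrt π * c * (1 - c ^ 2 / (3 * (K : ℝ) ^ 2))
        = K * (2 / sqrt π * (c / K - (c / K) ^ 3 / 3)) := by field_simp
    _ ≤ K * swapRejOdds (c / K) := mul_le_mul_of_nonneg_left h hK0.le

/-- **The limit of `Σ_i r_i/s_i` as replicas are added at fixed stiffness is `2c/√π`** (squeeze between the
two brackets). [ours] -/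
theorem tendsto_deoBarrier {c : ℝ} (hc : 0 ≤ c) :
    Tendsto (fun K : ℕ => deoBarrier c K) atTop (𝓝 (2 / sqrt π * c)) := by
  set A := 2 / sqrt π * c with hA
  have hA0 : 0 ≤ A := by positivity
  have hnat : Tendsto (fun K : ℕ => (K : ℝ)) atTop atTop := tendsto_natCast_atTop_atTop
  have hinv : Tendsto (fun K : ℕ => ((K : ℝ))⁻¹) atTop (𝓝 0) := tendsto_inv_atTop_zero.comp hnat
  -- lower envelope
  have hlow : Tendsto (fun K : ℕ => A * (1 - c ^ 2 / (3 * (K : ℝ) ^ 2))) atTop (𝓝 A) := by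
    have h2 : Tendsto (fun K : ℕ => c ^ 2 / 3 * ((K : ℝ))⁻¹ ^ 2) atTop (𝓝 (c ^ 2 / 3 * 0 ^ 2)) :=
      (hinv.pow 2).const_mul _
    rw [zero_pow two_ne_zero, mul_zero] at h2
    have h3 : Tendsto (fun K : ℕ => A * (1 - c ^ 2 / 3 * ((K : ℝ))⁻¹ ^ 2)) atTop (𝓝 (A * (1 - 0))) :=
      (tendsto_const_nhds.sub h2).const_mul A
    rw [sub_zero, mul_one] at h3
    refine h3.congr fun K => ?_
    congr 2
    rw [inv_pow]
    ring
  -- upper envelope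
  have hup : Tendsto (fun K : ℕ => A / (1 - A * ((K : ℝ))⁻¹)) atTop (𝓝 A) := by
    have h2 : Tendsto (fun K : ℕ => 1 - A * ((K : ℝ))⁻¹) atTop (𝓝 (1 - A * 0)) :=
      tendsto_const_nhds.sub (hinv.const_mul A)
    rw [mul_zero, sub_zero] at h2
    have h3 := (tendsto_const_nhds (x := A)).div h2 one_ne_zero
    rwa [div_one] at h3
  refine tendsto_of_tendsto_of_tendsto_of_le_of_le' hlow hup ?_ ?_
  · have h1 : ∀ᶠ K : ℕ in atTop, c ≤ (K : ℝ) := hnat.eventually (eventually_ge_atTop c)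
    have h2 : ∀ᶠ K : ℕ in atTop, 1 ≤ K := eventually_ge_atTop 1
    filter_upwards [h1, h2] with K hK1 hK2
    exact le_deoBarrier hc hK2 hK1
  · have h1 : ∀ᶠ K : ℕ in atTop, A < (K : ℝ) := hnat.eventually (eventually_gt_atTop A)
    filter_upwards [h1] with K hK1
    have h := deoBarrier_le hc hK1
    rwa [div_eq_mul_inv A (K : ℝ)] at h

/-- **The infimum is not attained: `2c/√π < deoBarrier c K` for every `K ≥ 1`** (`c > 0`; strictly decreasing
sequence, limit `2c/√π`). [ours] -/
theorem lt_deoBarrier {c : ℝ} (hc : 0 < c) {K : ℕ} (hK : 1 ≤ K) : 2 / sqrt π * c < deoBarrier c K := by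
  -- the shifted sequence `n ↦ deoBarrier c (n+1)` is antitone with the same limit
  have hanti : Antitone fun n : ℕ => deoBarrier c (n + 1) := by
    refine antitone_nat_of_succ_le fun n => ?_
    exact (deoBarrier_succ_lt hc (by omega)).le
  have hlim : Tendsto (fun n : ℕ => deoBarrier c (n + 1)) atTop (𝓝 (2 / sqrt π * c)) :=
    (tendsto_add_atTop_iff_nat 1).mpr (tendsto_deoBarrier hc.le)
  have hle : 2 / sqrt π * c ≤ deoBarrier c (K + 1) := hanti.le_of_tendsto hlim K
  exact lt_of_le_of_lt hle (deoBarrier_succ_lt hc hK)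

/-- **Dictionary**: with `c = Λ/(2√2)` the limit `2c/√π` is `Λ/√(2π)`. [ours] -/
theorem two_div_sqrt_pi_mul_reduced (Λ : ℝ) : 2 / sqrt π * (Λ / (2 * sqrt 2)) = Λ / sqrt (2 * π) := by
  have h2 : sqrt (2 * π) = sqrt 2 * sqrt π := Real.sqrt_mul (by norm_num) π
  have hs2 : sqrt 2 ≠ 0 := by positivity
  have hsp : sqrt π ≠ 0 := by positivity
  rw [h2]
  field_simp

end Barrier

end Summit.Ventures.LatticeQCDFlow.Scaling
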